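import Mathlib.Analysis.Fourier.AddCircleMulti
import Mathlib.Analysis.Calculus.Deriv.Mul
import Mathlib.Analysis.Calculus.Deriv.Shift
import Literature.Analysis.FunctionSpaces.Complexify
import Literature.Analysis.FunctionSpaces.FlatTorus
import Literature.Analysis.FunctionSpaces.TorusCalculus
import Literature.Analysis.FunctionSpaces.TorusCalculusProofs
import Literature.Analysis.FunctionSpaces.TorusSobolevNorm
import Literature.Analysis.FunctionSpaces.TorusFluidGlue
import HarnessLib

/-!
# Fourier coefficients of derivatives on `T^d`; Parseval for gradients

Grafakos 2014, Prop. 3.2.6 (8) (PDF §3.2.2): for `f ∈ C¹(T^n)`, `𝓕(∂ⱼ f)(m) = 2πi mⱼ 𝓕f(m)`;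
together with Parseval (Prop. 3.2.7 (3), Mathlib `UnitAddTorus.hasSum_sq_mFourierCoeff`) this
identifies the derivative-based and the spectral squared gradient norms of smooth fields.
This file proves, for the global `volume` convention of H21 (`Torus.volume_eq_pi_haarAddCircle`
transports Mathlib's local Haar volume):

* `Torus.partialDeriv_mFourier` — `∂ⱼ e_m = 2πi mⱼ e_m` for the characters
  `e_m = UnitAddTorus.mFourier m`;
* `Torus.mFourierCoeff_partialDeriv` — `𝓕(∂ⱼ g)(k) = (2πi kⱼ) • 𝓕g(k)` for smooth `g` with
  values in a complex normed space (integration by parts on the torus,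
  `Torus.integral_partialDeriv_eq_zero_holds`);
* `Torus.hasSum_sq_mFourierCoeff_of_continuous` — Parseval `∑ ‖𝓕g(k)‖² = ∫ ‖g‖²` for continuous
  scalar `g`, and `Torus.hasSum_sq_mFourierCoeff_euclidean` for continuous
  `EuclideanSpace ℂ ι`-valued `g` (componentwise);
* `Torus.gradNormSq_eq_toReal_eGradNormSq_holds` — **discharge** of the named fact
  `Torus.gradNormSq_eq_toReal_eGradNormSq` of `TorusFluidGlue`
  (`∫ ∑ᵢ ‖∂ᵢ v‖² = 4π² ∑_k |k|² ‖v̂(k)‖²` for smooth real vector fields), with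
  `Torus.eGradNormSq_eq_ofReal_gradNormSq` and finiteness `Torus.eGradNormSq_lt_top`;
* `Torus.eSobolevNorm_one_sq_complexify_eq` — the `H¹` identity
  `‖v‖²_{H¹} = ∫ ‖v‖² + (4π²)⁻¹ ∫ ∑ᵢ ‖∂ᵢ v‖²` for complexified smooth real vector fields (the
  case `F = EuclideanSpace ℂ d`, `f = complexify ∘ v` of the named fact
  `Torus.eSobolevNorm_one_sq_eq`, which is stated for arbitrary Hilbert targets), whence
  `Torus.IsSmooth.memSobolev_one_complexify`.

## References

* L. Grafakos, *Classical Fourier Analysis*, 3rd ed., GTM 249 (Springer 2014), Prop. 3.2.6 (8)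
  (`𝓕(∂^α f)(m) = (2πi m)^α 𝓕f(m)`), Prop. 3.2.7 (3) (Plancherel/Parseval on `T^n`).
  [Grafakos2014]
* C. Doering, C. Foias, *Energy dissipation in body-forced turbulence*, J. Fluid Mech. 467
  (2002), §2 (`‖∇u‖²` spectrally). [DoeringFoias2002]
-/

open MeasureTheory Set Filter Topology UnitAddTorus
open scoped ENNReal NNReal InnerProductSpace ContDiff

noncomputable section

namespace Literature.Analysis.FunctionSpaces

namespace Torus

variable {d : Type*} [Fintype d]

/-! ## Characters: multiplicativity and derivatives -/

section Characters

/-- The characters `e_m(x) = ∏ᵢ exp(2πi mᵢ xᵢ)` are multiplicative in the argument: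
`e_m(x + y) = e_m(x) e_m(y)`. [folklore] -/
theorem mFourier_apply_add (m : d → ℤ) (x y : UnitAddTorus d) :
    mFourier m (x + y) = mFourier m x * mFourier m y := by
  simp only [mFourier, ContinuousMap.coe_mk, Pi.add_apply, fourier_apply, zsmul_add,
    AddCircle.toCircle_add, Circle.coe_mul, Finset.prod_mul_distrib]

variable [DecidableEq d]

/-- The character `e_m` on the coordinate line through `0` in direction `eⱼ`:
`e_m (proj (t • eⱼ)) = exp(2πi mⱼ t)`. [folklore] -/
theorem mFourier_proj_smul_single (m : d → ℤ) (t : ℝ) (j : d) :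
    mFourier m (proj (t • EuclideanSpace.single j (1 : ℝ))) = fourier (m j) (t : UnitAddCircle) := by
  simp only [mFourier, ContinuousMap.coe_mk, proj_apply, PiLp.smul_apply, PiLp.single_apply,
    smul_eq_mul, mul_ite, mul_one, mul_zero]
  rw [Finset.prod_eq_single j]
  · simp
  · intro i _ hij
    simp [hij]
  · intro h
    exact absurd (Finset.mem_univ j) h

/-- **Derivative of the characters**: `∂ⱼ e_m (x) = 2πi mⱼ e_m(x)` (Grafakos 2014, proof of
Prop. 3.2.6 (8)). [folklore] -/
theorem partialDeriv_mFourier (m : d → ℤ) (j : d) (x : UnitAddTorus d) :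
    partialDeriv j (⇑(mFourier m) : UnitAddTorus d → ℂ) x =
      2 * Real.pi * Complex.I * (m j) * mFourier m x := by
  have hline : (fun t : ℝ => mFourier m (x + proj (t • EuclideanSpace.single j (1 : ℝ)))) =
      fun t : ℝ => mFourier m x * fourier (m j) (t : UnitAddCircle) := by
    funext t
    rw [mFourier_apply_add, mFourier_proj_smul_single]
  have hd : HasDerivAt (fun t : ℝ => mFourier m x * fourier (m j) (t : UnitAddCircle))
      (mFourier m x * (2 * Real.pi * Complex.I * (m j) / (1 : ℝ) *
        fourier (m j) ((0 : ℝ) : UnitAddCircle))) 0 :=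
    (hasDerivAt_fourier 1 (m j) 0).const_mul _
  rw [partialDeriv, Torus.lineDeriv, hline, hd.deriv]
  simp only [Complex.ofReal_one, div_one, QuotientAddGroup.mk_zero, fourier_eval_zero, mul_one]
  ring

end Characters

/-! ## Fourier coefficients of partial derivatives -/

section Coeff

variable [DecidableEq d]
variable {F : Type*} [NormedAddCommGroup F] [NormedSpace ℂ F]

omit [DecidableEq d] in
/-- Fourier coefficients for the global `volume` of H21: `𝓕g(k) = ∫ e_{-k}(x) • g(x) dx`
(Mathlib's `mFourierCoeff` integrates against the local Haar volume, which equals the global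
one, `Torus.volume_eq_pi_haarAddCircle`). [folklore] -/
theorem mFourierCoeff_eq_integral_volume (g : UnitAddTorus d → F) (k : d → ℤ) :
    mFourierCoeff g k = ∫ x, mFourier (-k) x • g x :=
  congrArg (fun μ : Measure (UnitAddTorus d) => ∫ x, mFourier (-k) x • g x ∂μ)
    (volume_eq_pi_haarAddCircle (d := d)).symm

/-- Along a coordinate line, a smooth `g` has derivative `∂ⱼ g (x)` at the base point. [folklore] -/
theorem IsSmooth.hasDerivAt_line_zero {G : Type*} [NormedAddCommGroup G] [NormedSpace ℝ G]
    {g : UnitAddTorus d → G} (hg : IsSmooth g) (j : d) (x : UnitAddTorus d) :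
    HasDerivAt (fun t : ℝ => g (x + proj (t • EuclideanSpace.single j (1 : ℝ))))
      (Torus.partialDeriv j g x) 0 := by
  have hc : ContDiff ℝ ∞ (fun t : ℝ => g (x + proj (t • EuclideanSpace.single j (1 : ℝ)))) := by
    have : (fun t : ℝ => g (x + proj (t • EuclideanSpace.single j (1 : ℝ)))) =
        Torus.liftAt g x ∘ fun t : ℝ => t • EuclideanSpace.single j (1 : ℝ) := by
      funext t; rfl
    rw [this]
    exact (hg.liftAt x).comp (contDiff_id.smul contDiff_const)
  exact ((hc.differentiable (by simp)).differentiableAt).hasDerivAt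

/-- Product rule for a character times a smooth vector function:
`∂ⱼ (e_m • g) = e_m • ∂ⱼ g + (2πi mⱼ e_m) • g`. [folklore] -/
theorem partialDeriv_mFourier_smul {g : UnitAddTorus d → F} (hg : IsSmooth g) (m : d → ℤ) (j : d)
    (x : UnitAddTorus d) :
    partialDeriv j (fun y => mFourier m y • g y) x =
      mFourier m x • partialDeriv j g x + (2 * Real.pi * Complex.I * (m j) * mFourier m x) • g x := by
  have hχ : IsSmooth (⇑(mFourier m) : UnitAddTorus d → ℂ) := isSmooth_mFourier m
  have h := ((hχ.hasDerivAt_line_zero j x).smul (hg.hasDerivAt_line_zero j x)).deriv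
  simp only [zero_smul, proj_zero, add_zero] at h
  rw [partialDeriv_mFourier] at h
  exact h

/-- **Fourier coefficients of derivatives** (Grafakos 2014, Prop. 3.2.6 (8)): for smooth `g`
on `T^d` with values in a complex normed space, `𝓕(∂ⱼ g)(k) = (2πi kⱼ) • 𝓕g(k)`. Proof:
`∫ e_{-k} • ∂ⱼ g = ∫ ∂ⱼ(e_{-k} • g) - ∫ (∂ⱼ e_{-k}) • g = 0 + 2πi kⱼ ∫ e_{-k} • g` by
`Torus.integral_partialDeriv_eq_zero_holds`. [cite: Grafakos2014, Prop. 3.2.6 (8)] -/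
theorem mFourierCoeff_partialDeriv {g : UnitAddTorus d → F} (hg : IsSmooth g) (j : d) (k : d → ℤ) :
    mFourierCoeff (partialDeriv j g) k = (2 * Real.pi * Complex.I * (k j)) • mFourierCoeff g k := by
  have hχ : IsSmooth (⇑(mFourier (-k)) : UnitAddTorus d → ℂ) := isSmooth_mFourier (-k)
  have hprod : IsSmooth (fun y => mFourier (-k) y • g y) := ContDiff.smul hχ hg
  have h0 : ∫ x, partialDeriv j (fun y => mFourier (-k) y • g y) x = 0 :=
    integral_partialDeriv_eq_zero_holds hprod j
  simp_rw [partialDeriv_mFourier_smul hg (-k) j] at h0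
  have hs1 : IsSmooth (fun y => mFourier (-k) y • partialDeriv j g y) :=
    ContDiff.smul hχ (hg.partialDeriv j)
  have hs2 : IsSmooth (fun x => (2 * Real.pi * Complex.I * ((-k) j) * mFourier (-k) x) • g x) :=
    ContDiff.smul (contDiff_const.mul hχ) hg
  rw [integral_add hs1.integrable hs2.integrable] at h0
  have hB : ∫ x, (2 * Real.pi * Complex.I * ((-k) j) * mFourier (-k) x) • g x =
      -((2 * Real.pi * Complex.I * (k j)) • ∫ x, mFourier (-k) x • g x) := by
    rw [← integral_smul, ← integral_neg]
    refine integral_congr_ae (ae_of_all _ fun x => ?_)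
    simp only [Pi.neg_apply, Int.cast_neg, smul_smul, ← neg_smul]
    congr 1
    ring
  rw [mFourierCoeff_eq_integral_volume, mFourierCoeff_eq_integral_volume,
    eq_neg_of_add_eq_zero_left h0, hB, neg_neg]

end Coeff

/-! ## Parseval for continuous functions (global volume) -/

section Parseval

/-- **Parseval** for continuous scalar functions on `T^d`, in H21's global-`volume` convention:
`∑_k ‖𝓕g(k)‖² = ∫ ‖g‖²` (Grafakos 2014, Prop. 3.2.7 (3); Mathlib
`UnitAddTorus.hasSum_sq_mFourierCoeff` for the `L²` class of `g`). [cite: Grafakos2014, Prop. 3.2.7 (3)] -/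
theorem hasSum_sq_mFourierCoeff_of_continuous {g : UnitAddTorus d → ℂ} (hg : Continuous g) :
    HasSum (fun k => ‖mFourierCoeff g k‖ ^ 2) (∫ x, ‖g x‖ ^ 2) := by
  set μ : Measure (UnitAddTorus d) := Measure.pi fun _ : d => AddCircle.haarAddCircle with hμ_def
  have hμ : (volume : Measure (UnitAddTorus d)) = μ := volume_eq_pi_haarAddCircle
  haveI : IsProbabilityMeasure μ := hμ ▸ inferInstance
  let G : C(UnitAddTorus d, ℂ) := ⟨g, hg⟩
  have key : HasSum (fun k => ‖mFourierCoeff (G.toLp 2 μ ℂ) k‖ ^ 2)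
      (∫ x, ‖(G.toLp 2 μ ℂ) x‖ ^ 2 ∂μ) :=
    UnitAddTorus.hasSum_sq_mFourierCoeff (G.toLp 2 μ ℂ)
  have hcoeff : ∀ k, mFourierCoeff (G.toLp 2 μ ℂ) k = mFourierCoeff g k := fun k =>
    UnitAddTorus.mFourierCoeff_toLp G k
  have hint : ∫ x, ‖(G.toLp 2 μ ℂ) x‖ ^ 2 ∂μ = ∫ x, ‖g x‖ ^ 2 := by
    rw [hμ]
    refine integral_congr_ae ?_
    filter_upwards [G.coeFn_toLp (p := 2) (μ := μ) (𝕜 := ℂ)] with x hx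
    rw [hx]
    rfl
  simp_rw [hcoeff, hint] at key
  exact key

/-- Coordinates of the Fourier coefficients of an integrable `ℂ^ι`-valued function are the
Fourier coefficients of the coordinates. [folklore] -/
theorem mFourierCoeff_apply_euclidean {ι : Type*} [Fintype ι] {g : UnitAddTorus d → EuclideanSpace ℂ ι}
    (hg : Integrable g volume) (k : d → ℤ) (i : ι) :
    mFourierCoeff g k i = mFourierCoeff (fun x => g x i) k := by
  rw [mFourierCoeff_eq_integral_volume, mFourierCoeff_eq_integral_volume, eval_integral_piLp]
  · rfl
  · intro j
    have h : Integrable (fun x => mFourier (-k) x • g x) volume :=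
      hg.bdd_smul 1 (mFourier (-k)).continuous.aestronglyMeasurable
        (Eventually.of_forall fun x => ((mFourier (-k)).norm_coe_le_norm x).trans_eq mFourier_norm)
    exact h.eval_piLp j

/-- **Parseval** for continuous `ℂ^ι`-valued functions on `T^d` (componentwise from the scalar
case): `∑_k ‖𝓕g(k)‖² = ∫ ‖g‖²` (Grafakos 2014, Prop. 3.2.7 (3)). [cite: Grafakos2014, Prop. 3.2.7 (3)] -/
theorem hasSum_sq_mFourierCoeff_euclidean {ι : Type*} [Fintype ι]
    {g : UnitAddTorus d → EuclideanSpace ℂ ι} (hg : Continuous g) :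
    HasSum (fun k => ‖mFourierCoeff g k‖ ^ 2) (∫ x, ‖g x‖ ^ 2) := by
  have hgi : ∀ i, Continuous fun x => g x i := fun i =>
    (EuclideanSpace.proj i : EuclideanSpace ℂ ι →L[ℂ] ℂ).continuous.comp hg
  have h : ∀ i, HasSum (fun k => ‖mFourierCoeff (fun x => g x i) k‖ ^ 2) (∫ x, ‖g x i‖ ^ 2) :=
    fun i => hasSum_sq_mFourierCoeff_of_continuous (hgi i)
  have hsum := hasSum_sum (s := Finset.univ) fun i _ => h i
  have hlhs : (fun k => ∑ i, ‖mFourierCoeff (fun x => g x i) k‖ ^ 2) =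
      fun k => ‖mFourierCoeff g k‖ ^ 2 := by
    funext k
    rw [EuclideanSpace.norm_sq_eq]
    simp_rw [mFourierCoeff_apply_euclidean hg.integrable_unitAddTorus]
  have hrhs : ∑ i, ∫ x, ‖g x i‖ ^ 2 = ∫ x, ‖g x‖ ^ 2 := by
    rw [← integral_finsetSum _ (f := fun i x => ‖g x i‖ ^ 2) fun i _ =>
      ((hgi i).norm.pow 2).integrable_unitAddTorus]
    simp_rw [EuclideanSpace.norm_sq_eq]
  rwa [hlhs, hrhs] at hsum

/-- Parseval in `ℝ≥0∞`: `∑' ‖𝓕g(k)‖ₑ² = ofReal (∫ ‖g‖²)` for continuous `ℂ^ι`-valued `g`. [folklore] -/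
theorem tsum_enorm_sq_mFourierCoeff_euclidean {ι : Type*} [Fintype ι]
    {g : UnitAddTorus d → EuclideanSpace ℂ ι} (hg : Continuous g) :
    ∑' k, ‖mFourierCoeff g k‖ₑ ^ 2 = ENNReal.ofReal (∫ x, ‖g x‖ ^ 2) := by
  have h := hasSum_sq_mFourierCoeff_euclidean hg
  rw [← h.tsum_eq, ENNReal.ofReal_tsum_of_nonneg (fun k => sq_nonneg _) h.summable]
  refine tsum_congr fun k => ?_
  rw [← ofReal_norm, ← ENNReal.ofReal_pow (norm_nonneg _)]

end Parseval

/-! ## Spectral versus derivative-based gradient norms of real vector fields -/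

section Gradient

variable [DecidableEq d]

/-- Partial derivatives commute with continuous linear maps: `∂ⱼ (L ∘ f) = L ∘ ∂ⱼ f` for smooth
`f`. [folklore] -/
theorem partialDeriv_clm_comp {F G : Type*} [NormedAddCommGroup F] [NormedSpace ℝ F]
    [NormedAddCommGroup G] [NormedSpace ℝ G] {f : UnitAddTorus d → F} (hf : IsSmooth f)
    (L : F →L[ℝ] G) (j : d) (x : UnitAddTorus d) :
    partialDeriv j (L ∘ f) x = L (partialDeriv j f x) :=
  (L.hasFDerivAt.comp_hasDerivAt (0 : ℝ) (hf.hasDerivAt_line_zero j x)).deriv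

variable {v : UnitAddTorus d → EuclideanSpace ℝ d}

omit [DecidableEq d] in
/-- The complexification of a smooth real vector field is smooth. [folklore] -/
theorem IsSmooth.complexify_comp (hv : IsSmooth v) : IsSmooth (EuclideanSpace.complexify ∘ v) :=
  hv.comp_clm EuclideanSpace.complexify.toContinuousLinearMap

/-- `∂ⱼ (complexify ∘ v) = complexify ∘ ∂ⱼ v`. [folklore] -/
theorem partialDeriv_complexify_comp (hv : IsSmooth v) (j : d) (x : UnitAddTorus d) :
    partialDeriv j (EuclideanSpace.complexify ∘ v) x =
      EuclideanSpace.complexify (partialDeriv j v x) :=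
  partialDeriv_clm_comp hv EuclideanSpace.complexify.toContinuousLinearMap j x

/-- Spectral first moment along one axis: for smooth real `v`,
`∑_k kⱼ² ‖𝓕(complexify ∘ v)(k)‖² = (4π²)⁻¹ ∫ ‖∂ⱼ v‖²` (from `𝓕(∂ⱼg) = 2πi kⱼ 𝓕g` and
Parseval for `∂ⱼ g`). [folklore] -/
theorem tsum_sq_mul_enorm_sq_mFourierCoeff_complexify (hv : IsSmooth v) (j : d) :
    ∑' k : d → ℤ, ENNReal.ofReal ((k j : ℝ) ^ 2) *
        ‖mFourierCoeff (EuclideanSpace.complexify ∘ v) k‖ₑ ^ 2 =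
      ENNReal.ofReal ((4 * Real.pi ^ 2)⁻¹ * ∫ x, ‖partialDeriv j v x‖ ^ 2) := by
  set g := EuclideanSpace.complexify ∘ v with hg_def
  have hg : IsSmooth g := hv.complexify_comp
  have hpar := tsum_enorm_sq_mFourierCoeff_euclidean (hg.partialDeriv j).continuous
  have hnorm : ∀ x, ‖partialDeriv j g x‖ = ‖partialDeriv j v x‖ := fun x => by
    rw [hg_def, partialDeriv_complexify_comp hv, EuclideanSpace.norm_complexify]
  simp_rw [hnorm, mFourierCoeff_partialDeriv hg, enorm_smul, mul_pow] at hpar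
  -- `‖2πi kⱼ‖ₑ² = ofReal (4π² kⱼ²)`
  have hck : ∀ k : d → ℤ, ‖(2 * (Real.pi : ℂ) * Complex.I * (k j : ℂ))‖ₑ ^ 2 =
      ENNReal.ofReal (4 * Real.pi ^ 2) * ENNReal.ofReal ((k j : ℝ) ^ 2) := by
    intro k
    rw [← ofReal_norm, ← ENNReal.ofReal_pow (norm_nonneg _),
      ← ENNReal.ofReal_mul (by positivity)]
    congr 1
    simp only [norm_mul, Complex.norm_ofNat, Complex.norm_real, Real.norm_eq_abs,
      Complex.norm_I, mul_one, Complex.norm_intCast, abs_of_pos Real.pi_pos]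
    rw [mul_pow, mul_pow, sq_abs]
    ring
  simp_rw [hck, mul_assoc] at hpar
  rw [ENNReal.tsum_mul_left] at hpar
  have h4 : ENNReal.ofReal (4 * Real.pi ^ 2) ≠ 0 := by
    rw [Ne, ENNReal.ofReal_eq_zero, not_le]; positivity
  have h4' : ENNReal.ofReal (4 * Real.pi ^ 2) ≠ ⊤ := ENNReal.ofReal_ne_top
  rw [ENNReal.ofReal_mul (by positivity), ENNReal.ofReal_inv_of_pos (by positivity), ← hpar,
    ← mul_assoc, ENNReal.inv_mul_cancel h4 h4', one_mul]

/-- Spectral first moment: for smooth real `v`,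
`∑_k |k|² ‖𝓕(complexify ∘ v)(k)‖² = (4π²)⁻¹ ∫ ∑ⱼ ‖∂ⱼ v‖² = (4π²)⁻¹ ‖∇v‖₂²`. [folklore] -/
theorem tsum_freqNormSq_mul_enorm_sq_mFourierCoeff_complexify (hv : IsSmooth v) :
    ∑' k : d → ℤ, ENNReal.ofReal (freqNormSq k) *
        ‖mFourierCoeff (EuclideanSpace.complexify ∘ v) k‖ₑ ^ 2 =
      ENNReal.ofReal ((4 * Real.pi ^ 2)⁻¹ * gradNormSq v) := by
  have hsplit : ∀ k : d → ℤ, ENNReal.ofReal (freqNormSq k) =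
      ∑ j, ENNReal.ofReal ((k j : ℝ) ^ 2) := fun k => by
    rw [freqNormSq, ENNReal.ofReal_sum_of_nonneg fun j _ => sq_nonneg _]
  simp_rw [hsplit, Finset.sum_mul]
  rw [Summable.tsum_finsetSum fun j _ => ENNReal.summable]
  simp_rw [tsum_sq_mul_enorm_sq_mFourierCoeff_complexify hv]
  rw [← ENNReal.ofReal_sum_of_nonneg fun j _ => by positivity, ← Finset.mul_sum, gradNormSq,
    integral_finsetSum _ (f := fun j x => ‖partialDeriv j v x‖ ^ 2) fun j _ =>
      ((hv.partialDeriv j).continuous.norm.pow 2).integrable_unitAddTorus]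

omit [DecidableEq d] in
/-- `(x^{1/2})² = x` in `ℝ≥0∞`. [folklore] -/
theorem _root_.ENNReal.rpow_half_sq (x : ℝ≥0∞) : (x ^ (1 / 2 : ℝ)) ^ 2 = x := by
  rw [← ENNReal.rpow_natCast, ← ENNReal.rpow_mul]
  norm_num

/-- The squared homogeneous `Ḣ¹` seminorm of a complexified smooth real vector field is
`(4π²)⁻¹ ‖∇v‖₂²`. [folklore] -/
theorem eHomSobolevSeminorm_one_complexify_sq (hv : IsSmooth v) :
    eHomSobolevSeminorm 1 (EuclideanSpace.complexify ∘ v) ^ 2 =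
      ENNReal.ofReal ((4 * Real.pi ^ 2)⁻¹ * gradNormSq v) := by
  rw [eHomSobolevSeminorm, ENNReal.rpow_half_sq, ← tsum_freqNormSq_mul_enorm_sq_mFourierCoeff_complexify hv]
  refine tsum_congr fun k => ?_
  by_cases hk : k = 0
  · subst hk
    simp
  · rw [if_neg hk, Real.rpow_one]

/-- **The spectral squared gradient norm of a smooth real vector field is its classical one**:
`eGradNormSq v = ofReal (∫ ∑ᵢ ‖∂ᵢ v‖²)` (Parseval and `𝓕(∂ⱼ v) = 2πi kⱼ v̂`; Grafakos 2014,
Prop. 3.2.6 (8), Prop. 3.2.7 (3); Doering–Foias 2002, §2). [folklore] -/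
theorem eGradNormSq_eq_ofReal_gradNormSq (hv : IsSmooth v) :
    eGradNormSq v = ENNReal.ofReal (gradNormSq v) := by
  rw [eGradNormSq, eHomSobolevSeminorm_one_complexify_sq hv, ← ENNReal.ofReal_mul (by positivity),
    ← mul_assoc, mul_inv_cancel₀ (by positivity), one_mul]

/-- The spectral squared gradient norm of a smooth real vector field is finite. [folklore] -/
theorem eGradNormSq_lt_top (hv : IsSmooth v) : eGradNormSq v < ⊤ := by
  rw [eGradNormSq_eq_ofReal_gradNormSq hv]
  exact ENNReal.ofReal_lt_top

/-- **Discharge** of the named fact `Torus.gradNormSq_eq_toReal_eGradNormSq` (`TorusFluidGlue`):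
for smooth `v`, `∫ ∑ᵢ ‖∂ᵢ v‖² = (4π² ∑_k |k|² ‖v̂(k)‖²).toReal` (Grafakos 2014, Prop. 3.2.6 (8)
and Prop. 3.2.7 (3)). [cite: Grafakos2014, Prop. 3.2.6 (8)] -/
theorem gradNormSq_eq_toReal_eGradNormSq_holds : gradNormSq_eq_toReal_eGradNormSq (d := d) := by
  intro v hv
  rw [eGradNormSq_eq_ofReal_gradNormSq hv, ENNReal.toReal_ofReal (gradNormSq_nonneg v)]

/-- **The `H¹` identity for complexified smooth real vector fields**:
`‖complexify ∘ v‖²_{H¹} = ofReal (∫ ‖v‖² + (4π²)⁻¹ ∫ ∑ᵢ ‖∂ᵢ v‖²)` — the instance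
`F = EuclideanSpace ℂ d`, `f = complexify ∘ v` of the named fact `Torus.eSobolevNorm_one_sq_eq`
(Grafakos 2014, Prop. 3.2.6 (8), Prop. 3.2.7 (3); weights `⟨k⟩² = 1 + |k|²`). [folklore] -/
theorem eSobolevNorm_one_complexify_sq (hv : IsSmooth v) :
    eSobolevNorm 1 (EuclideanSpace.complexify ∘ v) ^ 2 =
      ENNReal.ofReal ((∫ x, ‖v x‖ ^ 2) + (4 * Real.pi ^ 2)⁻¹ * gradNormSq v) := by
  have hg : IsSmooth (EuclideanSpace.complexify ∘ v) := hv.complexify_comp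
  rw [eSobolevNorm, ENNReal.rpow_half_sq]
  have hw : ∀ k : d → ℤ, ENNReal.ofReal (sobolevWeight 1 k ^ 2) = 1 + ENNReal.ofReal (freqNormSq k) := by
    intro k
    rw [sobolevWeight, ← Real.rpow_natCast, ← Real.rpow_mul (by linarith [freqNormSq_nonneg k])]
    norm_num
    rw [ENNReal.ofReal_add zero_le_one (freqNormSq_nonneg k), ENNReal.ofReal_one]
  simp_rw [hw, add_mul, one_mul]
  rw [ENNReal.tsum_add, tsum_freqNormSq_mul_enorm_sq_mFourierCoeff_complexify hv,
    tsum_enorm_sq_mFourierCoeff_euclidean hg.continuous,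
    ← ENNReal.ofReal_add (integral_nonneg fun x => sq_nonneg _)
      (mul_nonneg (by positivity) (gradNormSq_nonneg v))]
  congr 2
  refine integral_congr_ae (ae_of_all _ fun x => ?_)
  simp

/-- The `H¹` norm of a complexified smooth real vector field is finite. [folklore] -/
theorem eSobolevNorm_one_complexify_lt_top (hv : IsSmooth v) :
    eSobolevNorm 1 (EuclideanSpace.complexify ∘ v) < ⊤ := by
  have h := eSobolevNorm_one_complexify_sq hv
  by_contra htop
  rw [not_lt, top_le_iff] at htop
  rw [htop, ENNReal.top_pow two_ne_zero] at h
  exact ENNReal.top_ne_ofReal h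

/-- Complexified smooth real vector fields lie in `H¹(T^d)`. [folklore] -/
theorem IsSmooth.memSobolev_one_complexify (hv : IsSmooth v) :
    MemSobolev 1 (EuclideanSpace.complexify ∘ v) :=
  ⟨hv.complexify_comp.integrable, eSobolevNorm_one_complexify_lt_top hv⟩

end Gradient

end Torus

end Literature.Analysis.FunctionSpaces
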